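import Literature.NumberTheory.Automorphic.ArchBigCellTangentInverse
import Literature.NumberTheory.Automorphic.ArchMultiPermutationCharts
import HarnessLib

/-!
# The stabilizer vector field of a small Bruhat cell in the translated big-cell chart of `GL_n(K_∞)`

Topic `NumberTheory/Automorphic`; namespace `Literature.NumberTheory.Automorphic`. Fix an archimedean place
index `v`, a permutation `σ` and the translated chart `ẇ Ψ`, `Ψ(X₁, a, X₂) = (1 + X₁) w⁰ diag(a) (1 + X₂)`,
`ẇ` a multi-permutation matrix with `ẇ_v = P_{rev σ} = P_σ P_{rev}`, so that `ẇ_v Ψ_v = P_σ N⁻ B`. In this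
chart the cell `B P_σ U_n` at the place `v` is the linear subspace `{b = 0}` of the *bad coordinates*
`b = (1_v (X₁)_{ij})_{(i,j) bad}`, `(i, j)` bad iff `i < j` and `σ⁻¹(rev j) < σ⁻¹(rev i)`:

* `badPair`, `piBad`, `projB` (the continuous idempotent `(X₁, a, X₂) ↦ (π''_v X₁, 0, 0)` of the parameter
  space) and `projB_eq_zero_of_mem_bruhatCell` (**cell recognition**, from `BruhatCellTranslatedBigCell`);
* the **stabilizer field data** for a bad pair `(i₀, j₀)` and `θ ∈ K_v ⊆ K_∞`: `Y₀ = θ E_{j₀ i₀}`,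
  `stabY e = (1 + π'X₁) Y₀ (1 + π'X₁)⁻¹` (`π' = id - π''`), `stabX e = (diag(a)(1 + X₂))⁻¹ (w⁰ Y₀ w⁰) (diag(a)(1 + X₂))`,
  and the tangent datum `stabT e = -stabY(e) Ψ(e) + Ψ(e) stabX(e)`, whose image under `d(Ψ⁻¹)_{Ψ e}` is the
  field `W = L_{stabY} + R_{stabX}` in coordinates (`ArchBigCellTangentInverse`);
* `stabT_eq_zero_of_piBad_eq_zero`: **`W` vanishes on the cell** `{b = 0}` (there `π'X₁ = X₁` and
  `Ψ stabX Ψ⁻¹ = Ad(1 + X₁) Y₀ = stabY`);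
* `stabT_line_bad`, `fderiv_stabT_apply_bad`: along a bad direction `δ = (δ₁, 0, 0)`, `π''δ₁ = δ₁`, through
  `e₀ = (0, a, 0)`, `stabT` is affine with derivative `[δ₁, Y₀] w⁰ diag(a)`; hence (`fieldW = d(Ψ⁻¹)(stabT)`,
  `hasFDerivAt_fieldW`, `fderiv_fieldW_apply_bad`) the bad part of the `X₁`-component of `DW(e₀) δ` is
  `π''([δ₁, Y₀])` (`projB_fderiv_fieldW_apply_bad`), which strictly lowers the height `j - i` of the bad matrix
  units and is therefore nilpotent (`isNilpotent_projB_fderiv_fieldW_projB`).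

This is the vector-field input of the first-order (transversal) step of the Gelfand–Kazhdan–Shalika analysis
of quasi-invariant distributions near a small cell (Shalika 1974, §2–§3; Hörmander, Thm. 2.3.5 for the
conclusion drawn from it in `NormalDescentTransport`). Everything is proved; no named fact is introduced.

## References

* J. A. Shalika, *The multiplicity one theorem for `GL_n`*, Ann. of Math. 100 (1974), §2–§3. [Shalika1974]
* L. Hörmander, *The Analysis of Linear Partial Differential Operators I* (1983), Thm. 2.3.5. [HormanderALPDO1]
-/

noncomputable section

open MeasureTheory Measure NumberField NumberField.InfinitePlace NumberField.mixedEmbedding IsDedekindDomain Set Filter Matrix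
open Literature.Analysis.Distribution
open scoped MatrixGroups Topology Classical ContDiff Matrix.Norms.Operator

namespace Literature.NumberTheory.Automorphic

variable {n : ℕ} {K : Type} [Field K] [NumberField K]

-- as in `ArchGardingWhittaker`: the scoped `L∞`-operator normed ring structure on matrices is only
-- reducibly defeq to the Pi uniformity
set_option backward.isDefEq.respectTransparency false

local notation "R∞" => mixedSpace K
local notation "Mat" => Matrix (Fin n) (Fin n) (mixedSpace K)
local notation "G∞" => GL (Fin n) (mixedSpace K)
local notation "E∞" => CellParam n (mixedSpace K)
local notation "w₀" => ((weylLong n (mixedSpace K) : GL (Fin n) (mixedSpace K)) : Matrix (Fin n) (Fin n) (mixedSpace K))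

/-- `M_n(K_∞)` is finite-dimensional over `ℝ` (local instance, as in `ArchBigCellDerivatives`). [folklore] -/
private theorem finiteDimensional_matrix_mixedSpace_sf : FiniteDimensional ℝ (Matrix (Fin n) (Fin n) (mixedSpace K)) :=
  Module.Finite.matrix

attribute [local instance] finiteDimensional_matrix_mixedSpace_sf

/-- The parameter space is finite-dimensional over `ℝ` (local instance). [folklore] -/
private theorem finiteDimensional_cellParam_sf : FiniteDimensional ℝ (CellParam n (mixedSpace K)) := by
  unfold CellParam; infer_instance

attribute [local instance] finiteDimensional_cellParam_sf

/-! ### 1. Bad pairs and the bad projection -/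

section Bad

variable (v : PlaceIdx K) (σ : Equiv.Perm (Fin n))

omit [NumberField K] in
/-- **Bad pairs** of the cell `σ`: `i < j` with `σ⁻¹(rev j) < σ⁻¹(rev i)` — the entries of `X₁` transversal to
the cell in the chart `P_σ N⁻ B`. [cite: Shalika1974, §2] -/
def badPair (i j : Fin n) : Prop := i < j ∧ σ.symm j.rev < σ.symm i.rev

/-- **The bad part at the place `v`**: keep the `v`-components of the bad entries. [folklore] -/
def piBad (X : Mat) : Mat := fun i j => if badPair σ i j then (placeIdem v : R∞) * X i j else 0

omit [NumberField K] in
/-- Entries of `piBad`. [folklore] -/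
theorem piBad_apply (X : Mat) (i j : Fin n) :
    piBad v σ X i j = if badPair σ i j then (placeIdem v : R∞) * X i j else 0 := rfl

omit [NumberField K] in
/-- `piBad` is additive. [folklore] -/
theorem piBad_add (X Y : Mat) : piBad v σ (X + Y) = piBad v σ X + piBad v σ Y := by
  funext i j; simp only [piBad_apply, Matrix.add_apply]; split_ifs <;> simp [mul_add]

omit [NumberField K] in
/-- `piBad` commutes with real scalars. [folklore] -/
theorem piBad_smul (c : ℝ) (X : Mat) : piBad v σ (c • X) = c • piBad v σ X := by
  funext i j; simp only [piBad_apply, Matrix.smul_apply]; split_ifs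
  · exact mul_smul_comm c (placeIdem v : R∞) (X i j)
  · simp

omit [NumberField K] in
/-- `piBad` is idempotent. [folklore] -/
theorem piBad_piBad (X : Mat) : piBad v σ (piBad v σ X) = piBad v σ X := by
  funext i j; simp only [piBad_apply]; split_ifs <;> simp [← mul_assoc, placeIdem_mul_self]

omit [NumberField K] in
/-- `piBad X` is strictly upper. [folklore] -/
theorem piBad_mem_strictUpper (X : Mat) : piBad v σ X ∈ strictUpper n R∞ := by
  intro i j hji
  rw [piBad_apply, if_neg]
  exact fun h => absurd h.1 (not_lt.2 hji)

omit [NumberField K] in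
/-- `piBad X = 0` iff the `v`-components of the bad entries of `X` vanish. [folklore] -/
theorem piBad_eq_zero_iff (X : Mat) : piBad v σ X = 0 ↔ ∀ i j, badPair σ i j → placeEmbC v (X i j) = 0 := by
  constructor
  · intro h i j hij
    have hij' := congr_fun (congr_fun h i) j
    rw [piBad_apply, if_pos hij, Matrix.zero_apply, placeIdem_mul_eq_zero_iff] at hij'
    exact hij'
  · intro h; funext i j
    rw [piBad_apply, Matrix.zero_apply]
    split_ifs with hij
    · exact (placeIdem_mul_eq_zero_iff v _).2 (h i j hij)
    · rfl

/-- `piBad` as a real-linear endomorphism of `𝔫`. [folklore] -/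
def piBadLin : ↥(strictUpperReal n R∞) →ₗ[ℝ] ↥(strictUpperReal n R∞) where
  toFun X := ⟨piBad v σ (X : Mat), piBad_mem_strictUpper v σ _⟩
  map_add' X Y := Subtype.ext (by simp [piBad_add])
  map_smul' c X := Subtype.ext (by simp [piBad_smul])

/-- **The bad projection of the parameter space**: `(X₁, a, X₂) ↦ (π''_v X₁, 0, 0)`. [folklore] -/
def projB : E∞ →L[ℝ] E∞ :=
  LinearMap.toContinuousLinearMap
    ((LinearMap.inl ℝ ↥(strictUpperReal n R∞) ((Fin n → R∞) × ↥(strictUpperReal n R∞))) ∘ₗ (piBadLin v σ) ∘ₗ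
      (LinearMap.fst ℝ ↥(strictUpperReal n R∞) ((Fin n → R∞) × ↥(strictUpperReal n R∞))))

/-- Unfolding `projB`. [folklore] -/
theorem projB_apply (e : E∞) :
    projB v σ e = (⟨piBad v σ (e.1 : Mat), piBad_mem_strictUpper v σ _⟩, 0, 0) := rfl

/-- The first component of `projB e` is `π''_v X₁`. [folklore] -/
@[simp] theorem projB_fst (e : E∞) : ((projB v σ e).1 : Mat) = piBad v σ (e.1 : Mat) := rfl

/-- The torus component of `projB e` vanishes. [folklore] -/
@[simp] theorem projB_snd_fst (e : E∞) : (projB v σ e).2.1 = 0 := rfl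

/-- The `X₂`-component of `projB e` vanishes. [folklore] -/
@[simp] theorem projB_snd_snd (e : E∞) : (projB v σ e).2.2 = 0 := rfl

/-- **`projB` is idempotent.** [folklore] -/
theorem projB_projB (e : E∞) : projB v σ (projB v σ e) = projB v σ e := by
  rw [projB_apply, projB_apply]
  congr 2
  exact piBad_piBad v σ _

/-- `projB e = 0` iff `π''_v X₁ = 0`. [folklore] -/
theorem projB_eq_zero_iff (e : E∞) : projB v σ e = 0 ↔ piBad v σ (e.1 : Mat) = 0 := by
  rw [projB_apply, Prod.mk_eq_zero, Prod.mk_eq_zero]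
  simp only [and_true]
  rw [← Submodule.coe_eq_zero]

/-- A vector in the image of `projB` has only bad `X₁`-entries: `e = projB e` iff `X₁ = π''X₁`, `a = 0`, `X₂ = 0`.
[folklore] -/
theorem projB_eq_self_iff (e : E∞) : projB v σ e = e ↔ piBad v σ (e.1 : Mat) = (e.1 : Mat) ∧ e.2.1 = 0 ∧ e.2.2 = 0 := by
  obtain ⟨X₁, a, X₂⟩ := e
  rw [projB_apply, Prod.mk.injEq, Prod.mk.injEq]
  simp only [Subtype.ext_iff]
  constructor
  · rintro ⟨h1, h2, h3⟩; exact ⟨h1, h2.symm, h3.symm⟩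
  · rintro ⟨h1, h2, h3⟩; exact ⟨h1, h2.symm, h3.symm⟩

end Bad

/-! ### 2. Cell recognition in the translated chart -/

section Recognition

variable (v : PlaceIdx K) (σ : Equiv.Perm (Fin n))

omit [NumberField K] in
/-- The place projection of a mapped unipotent `1 + X`, `X` strictly upper, is upper unitriangular. [folklore] -/
theorem placeGL_unitri_mem_upperUnitriangular (X : Mat) (hX : X ∈ strictUpper n R∞) :
    placeGL v (unitri X hX) ∈ upperUnitriangular (Fin n) ℂ := by
  rw [mem_upperUnitriangular_iff]
  refine ⟨fun i j hij => ?_, fun i => ?_⟩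
  · have hij' : j < i := hij
    rw [placeGL_apply, coe_unitri, Matrix.add_apply, Matrix.one_apply, if_neg (ne_of_gt hij'), hX i j hij'.le]
    simp
  · rw [placeGL_apply, coe_unitri, Matrix.add_apply, Matrix.one_apply_eq, hX i i le_rfl]
    simp

omit [NumberField K] in
/-- The place projection of `w⁰` is `P_{rev}`. [folklore] -/
theorem placeGL_weylLong : placeGL v (weylLong n (mixedSpace K)) = (permGL (Fin.revPerm : Equiv.Perm (Fin n)) : GL (Fin n) ℂ) :=
  Units.ext (by rw [coe_placeGL]; exact weylLong_map v)

/-- The torus coordinate at the place `v` as units of `ℂ`. [folklore] -/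
def placeTorus {a : Fin n → R∞} (ha : ∀ i, IsUnit (a i)) : Fin n → ℂˣ :=
  fun i => Units.mk0 (placeEmbC v (a i)) (isUnit_iff_placeEmbC_ne_zero.1 (ha i) v)

omit [NumberField K] in
/-- The place projection of `diag(a)` is `diagonalGL (a_v)`. [folklore] -/
theorem placeGL_diagUnitsGL {a : Fin n → R∞} (ha : ∀ i, IsUnit (a i)) :
    placeGL v (diagUnitsGL a ha) = diagonalGL (Fin n) ℂ (placeTorus v ha) := by
  refine Units.ext ?_
  rw [coe_placeGL, coe_diagUnitsGL, coe_diagonalGL, Matrix.diagonal_map (map_zero _)]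
  rfl

/-- **Cell recognition in the translated chart**: if `ẇ_v = P_{rev σ}` and `(ẇ Ψ(e))_v` lies in the Bruhat cell
`B P_σ U_n` of `GL_n(ℂ)`, then the bad coordinates of `e` vanish: `projB e = 0`.
[cite: Shalika1974, §2] -/
theorem projB_eq_zero_of_mem_bruhatCell {τ : PlaceIdx K → Equiv.Perm (Fin n)} (hτ : τ v = Fin.revPerm * σ)
    {e : E∞} (he : e ∈ cellSource n R∞)
    (hmem : placeGL v (multiPermGL τ * cellChartGL e he) ∈ bruhatCell (K := ℂ) σ) : projB v σ e = 0 := by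
  obtain ⟨⟨X₁, hX₁⟩, a, ⟨X₂, hX₂⟩⟩ := e
  have hX₁' : X₁ ∈ strictUpper n R∞ := hX₁
  have ha : ∀ i, IsUnit (a i) := he
  -- the factors at the place `v`
  set U₁ : GL (Fin n) ℂ := placeGL v (unitri X₁ hX₁') with hU₁
  set U₂ : GL (Fin n) ℂ := placeGL v (unitri X₂ (hX₂ : X₂ ∈ strictUpper n R∞)) with hU₂
  set N : GL (Fin n) ℂ := permGL Fin.revPerm * U₁ * permGL Fin.revPerm with hN
  have hfac : placeGL v (multiPermGL τ * cellChartGL (⟨X₁, hX₁⟩, a, ⟨X₂, hX₂⟩) he) =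
      permGL σ * N * diagonalGL (Fin n) ℂ (placeTorus v ha) * U₂ := by
    rw [map_mul, placeGL_multiPermGL, hτ, ← permGL_mul_permGL, cellChartGL, map_mul, map_mul, map_mul, placeGL_weylLong,
      placeGL_diagUnitsGL, hN, hU₁, hU₂]
    simp only [mul_assoc]
  have hNapply : ∀ i j, ((N : GL (Fin n) ℂ) : Matrix (Fin n) (Fin n) ℂ) i j = placeEmbC v ((1 + X₁) i.rev j.rev) := by
    intro i j
    rw [hN, Units.val_mul, Units.val_mul, permGL_mul_mul_permGL_apply, Fin.revPerm_symm, Fin.revPerm_apply, Fin.revPerm_apply,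
      hU₁, placeGL_apply, coe_unitri]
  have hNlow : IsLowerUnitriangular ((N : GL (Fin n) ℂ) : Matrix (Fin n) (Fin n) ℂ) := by
    refine ⟨fun i => ?_, fun i j hij => ?_⟩
    · rw [hNapply, Matrix.add_apply, Matrix.one_apply_eq, hX₁' _ _ le_rfl]; simp
    · rw [hNapply, Matrix.add_apply, Matrix.one_apply, if_neg (fun h => (ne_of_lt hij) (Fin.rev_injective h)),
        hX₁' _ _ (Fin.rev_le_rev.2 hij.le)]
      simp
  rw [hfac] at hmem
  rw [projB_eq_zero_iff, piBad_eq_zero_iff]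
  intro i j hij
  have h := entry_eq_zero_of_permGL_mul_mem_bruhatCell hNlow (placeTorus v ha) (placeGL_unitri_mem_upperUnitriangular v X₂ hX₂) hmem
    (k := i.rev) (l := j.rev) (Fin.rev_lt_rev.2 hij.1) hij.2
  rw [hNapply, Fin.rev_rev, Fin.rev_rev, Matrix.add_apply, Matrix.one_apply, if_neg (ne_of_lt hij.1), zero_add] at h
  exact h

end Recognition

/-! ### 3. The stabilizer data `Y₀`, `stabY`, `stabX`, `stabT` -/

section Stabilizer

variable (v : PlaceIdx K) (σ : Equiv.Perm (Fin n))

omit [NumberField K] in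
/-- **The good part** `π' X = X - π''_v X`. [folklore] -/
def piGood (v : PlaceIdx K) (σ : Equiv.Perm (Fin n)) (X : Mat) : Mat := X - piBad v σ X

omit [NumberField K] in
/-- `π' X + π'' X = X`. [folklore] -/
theorem piGood_add_piBad (X : Mat) : piGood v σ X + piBad v σ X = X := sub_add_cancel X _

omit [NumberField K] in
/-- `π' X` is strictly upper when `X` is. [folklore] -/
theorem piGood_mem_strictUpper {X : Mat} (hX : X ∈ strictUpper n R∞) : piGood v σ X ∈ strictUpper n R∞ :=
  (strictUpper n R∞).sub_mem hX (piBad_mem_strictUpper v σ X)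

omit [NumberField K] in
/-- On the cell, `π' X = X`. [folklore] -/
theorem piGood_eq_self_of_piBad_eq_zero {X : Mat} (h : piBad v σ X = 0) : piGood v σ X = X := by
  rw [piGood, h, sub_zero]

omit [NumberField K] in
/-- `π' (π'' X) = 0`. [folklore] -/
theorem piGood_piBad (X : Mat) : piGood v σ (piBad v σ X) = 0 := by
  rw [piGood, piBad_piBad, sub_self]

omit [NumberField K] in
/-- `π'` is additive. [folklore] -/
theorem piGood_add (X Y : Mat) : piGood v σ (X + Y) = piGood v σ X + piGood v σ Y := by
  simp only [piGood, piBad_add]; abel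

omit [NumberField K] in
/-- `π'` commutes with real scalars. [folklore] -/
theorem piGood_smul (c : ℝ) (X : Mat) : piGood v σ (c • X) = c • piGood v σ X := by
  simp only [piGood, piBad_smul, smul_sub]

omit [NumberField K] in
/-- `π'' 0 = 0`. [folklore] -/
@[simp] theorem piBad_zero : piBad v σ (0 : Mat) = 0 := by
  have h := piBad_smul v σ (0 : ℝ) (0 : Mat)
  rwa [zero_smul, zero_smul] at h

omit [NumberField K] in
/-- `π' 0 = 0`. [folklore] -/
@[simp] theorem piGood_zero : piGood v σ (0 : Mat) = 0 := by
  rw [piGood, piBad_zero, sub_zero]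

variable (i₀ j₀ : Fin n) (θ : mixedSpace K)

omit [NumberField K] in
/-- **The root vector `Y₀ = θ E_{j₀ i₀}`** (lower triangular when `(i₀, j₀)` is a bad pair). [cite: Shalika1974, §2] -/
def rootLow (i₀ j₀ : Fin n) (θ : R∞) : Mat := Matrix.single j₀ i₀ θ

/-- **The good unipotent `1 + π' X₁`.** [folklore] -/
def unipGood (v : PlaceIdx K) (σ : Equiv.Perm (Fin n)) (e : E∞) : Mat := 1 + piGood v σ (e.1 : Mat)

/-- `1 + π' X₁` is a unit. [folklore] -/
theorem isUnit_unipGood (e : E∞) : IsUnit (unipGood v σ e) :=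
  ⟨unitri (piGood v σ (e.1 : Mat)) (piGood_mem_strictUpper v σ e.1.2), rfl⟩

/-- **`stabY e = Ad(1 + π'X₁) Y₀`.** [cite: Shalika1974, §2] -/
def stabY (v : PlaceIdx K) (σ : Equiv.Perm (Fin n)) (i₀ j₀ : Fin n) (θ : R∞) (e : E∞) : Mat :=
  unipGood v σ e * rootLow i₀ j₀ θ * Ring.inverse (unipGood v σ e)

/-- **The torus–unipotent factor `diag(a) (1 + X₂)` of the chart.** [folklore] -/
def torusUnip (e : E∞) : Mat := Matrix.diagonal e.2.1 * (1 + (e.2.2 : Mat))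

/-- `diag(a) (1 + X₂)` is a unit on `cellSource`. [folklore] -/
theorem isUnit_torusUnip {e : E∞} (he : e ∈ cellSource n R∞) : IsUnit (torusUnip e) :=
  ⟨diagUnitsGL e.2.1 he * unitri (e.2.2 : Mat) e.2.2.2, by rw [Units.val_mul, coe_diagUnitsGL, coe_unitri]; rfl⟩

/-- **`stabX e = Ad((diag(a)(1 + X₂))⁻¹) (w⁰ Y₀ w⁰)`.** [cite: Shalika1974, §2] -/
def stabX (i₀ j₀ : Fin n) (θ : R∞) (e : E∞) : Mat := Ring.inverse (torusUnip e) * (w₀ * rootLow i₀ j₀ θ * w₀) * torusUnip e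

/-- **The tangent datum `stabT e = -stabY(e) Ψ(e) + Ψ(e) stabX(e)`**, whose image under `d(Ψ⁻¹)_{Ψ e}` is the
vector field `L_{stabY} + R_{stabX}` in coordinates (`cellVecL`, `cellVecR`). [cite: Shalika1974, §2] -/
def stabT (v : PlaceIdx K) (σ : Equiv.Perm (Fin n)) (i₀ j₀ : Fin n) (θ : R∞) (e : E∞) : Mat :=
  -(stabY v σ i₀ j₀ θ e * cellChart e) + cellChart e * stabX i₀ j₀ θ e

/-- The chart factors as `Ψ(e) = (1 + X₁) (w⁰ (diag(a) (1 + X₂)))`. [folklore] -/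
theorem cellChart_eq_mul_torusUnip (e : E∞) : cellChart e = (1 + (e.1 : Mat)) * (w₀ * torusUnip e) := by
  simp only [cellChart_apply, torusUnip, Matrix.mul_assoc]

/-- **The field vanishes on the cell**: if `π''_v X₁ = 0` then `stabT e = 0` (on the cell `π'X₁ = X₁` and
`Ψ stabX Ψ⁻¹ = Ad(1 + X₁) Y₀ = stabY`). [cite: Shalika1974, §2] -/
theorem stabT_eq_zero_of_piBad_eq_zero {e : E∞} (he : e ∈ cellSource n R∞) (hb : piBad v σ (e.1 : Mat) = 0) :
    stabT v σ i₀ j₀ θ e = 0 := by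
  have hg : unipGood v σ e = 1 + (e.1 : Mat) := by rw [unipGood, piGood_eq_self_of_piBad_eq_zero v σ hb]
  set g : Mat := unipGood v σ e with hgdef
  set h : Mat := torusUnip e with hhdef
  set Y₀ : Mat := rootLow i₀ j₀ θ
  have h1 : Ring.inverse g * g = 1 := Ring.inverse_mul_cancel g (isUnit_unipGood v σ e)
  have h2 : h * Ring.inverse h = 1 := Ring.mul_inverse_cancel h (isUnit_torusUnip he)
  have hww : w₀ * w₀ = 1 := weylLong_mul_weylLong
  rw [stabT, stabY, stabX, cellChart_eq_mul_torusUnip, ← hg, ← hgdef, ← hhdef]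
  calc -(g * Y₀ * Ring.inverse g * (g * (w₀ * h))) + g * (w₀ * h) * (Ring.inverse h * (w₀ * Y₀ * w₀) * h)
      = -(g * Y₀ * (Ring.inverse g * g) * (w₀ * h)) + g * w₀ * (h * Ring.inverse h) * w₀ * Y₀ * w₀ * h := by
        noncomm_ring
    _ = -(g * Y₀ * (w₀ * h)) + g * (w₀ * w₀) * Y₀ * w₀ * h := by rw [h1, h2]; noncomm_ring
    _ = 0 := by rw [hww]; noncomm_ring

end Stabilizer

/-! ### 4. Smoothness of the stabilizer data -/

section Smooth

variable (v : PlaceIdx K) (σ : Equiv.Perm (Fin n)) (i₀ j₀ : Fin n) (θ : mixedSpace K)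

/-- `piBad` as a continuous linear map of `M_n(K_∞)`. [folklore] -/
def piBadCLM (v : PlaceIdx K) (σ : Equiv.Perm (Fin n)) : Mat →L[ℝ] Mat :=
  LinearMap.toContinuousLinearMap
    { toFun := piBad v σ, map_add' := piBad_add v σ, map_smul' := piBad_smul v σ }

/-- Unfolding `piBadCLM`. [folklore] -/
@[simp] theorem piBadCLM_apply (X : Mat) : piBadCLM v σ X = piBad v σ X := rfl

/-- `e ↦ X₁` is smooth. [folklore] -/
theorem contDiff_cellFst : ContDiff ℝ ∞ fun e : E∞ => ((e.1 : ↥(strictUpperReal n R∞)) : Mat) :=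
  ((strictUpperReal n R∞).subtypeL.contDiff).comp contDiff_fst

/-- `e ↦ X₂` is smooth. [folklore] -/
theorem contDiff_cellSndSnd : ContDiff ℝ ∞ fun e : E∞ => ((e.2.2 : ↥(strictUpperReal n R∞)) : Mat) :=
  ((strictUpperReal n R∞).subtypeL.contDiff).comp (contDiff_snd.comp contDiff_snd)

/-- `e ↦ diag(a)` is smooth. [folklore] -/
theorem contDiff_cellDiag : ContDiff ℝ ∞ fun e : E∞ => (Matrix.diagonal e.2.1 : Mat) :=
  (diagonalCLM (n := n) (R := R∞)).contDiff.comp (contDiff_fst.comp contDiff_snd)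

/-- `unipGood` is smooth (affine). [folklore] -/
theorem contDiff_unipGood : ContDiff ℝ ∞ (unipGood v σ : E∞ → Mat) := by
  have h : (unipGood v σ : E∞ → Mat) = fun e => 1 + (((e.1 : ↥(strictUpperReal n R∞)) : Mat) - piBadCLM v σ ((e.1 : ↥(strictUpperReal n R∞)) : Mat)) := by
    funext e; rfl
  rw [h]
  exact contDiff_const.add (contDiff_cellFst.sub ((piBadCLM v σ).contDiff.comp contDiff_cellFst))

/-- `Ring.inverse ∘ unipGood` is smooth (inversion is smooth at units). [folklore] -/
theorem contDiff_inverse_unipGood : ContDiff ℝ ∞ fun e : E∞ => Ring.inverse (unipGood v σ e) := by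
  rw [contDiff_iff_contDiffAt]
  intro e
  obtain ⟨u, hu⟩ := isUnit_unipGood v σ e
  have h1 : ContDiffAt ℝ ∞ Ring.inverse (unipGood v σ e) := by rw [← hu]; exact contDiffAt_ringInverse ℝ u
  exact h1.comp e (contDiff_unipGood v σ).contDiffAt

/-- **`stabY` is smooth.** [folklore] -/
theorem contDiff_stabY : ContDiff ℝ ∞ (stabY v σ i₀ j₀ θ : E∞ → Mat) :=
  ((contDiff_unipGood v σ).mul contDiff_const).mul (contDiff_inverse_unipGood v σ)

/-- `torusUnip` is smooth. [folklore] -/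
theorem contDiff_torusUnip : ContDiff ℝ ∞ (torusUnip : E∞ → Mat) :=
  contDiff_cellDiag.mul (contDiff_const.add contDiff_cellSndSnd)

/-- `Ring.inverse ∘ torusUnip` is smooth on `cellSource`. [folklore] -/
theorem contDiffOn_inverse_torusUnip : ContDiffOn ℝ ∞ (fun e : E∞ => Ring.inverse (torusUnip e)) (cellSource n R∞) := by
  intro e he
  obtain ⟨u, hu⟩ := isUnit_torusUnip he
  have h1 : ContDiffAt ℝ ∞ Ring.inverse (torusUnip e) := by rw [← hu]; exact contDiffAt_ringInverse ℝ u
  exact (h1.comp e contDiff_torusUnip.contDiffAt).contDiffWithinAt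

/-- **`stabX` is smooth on `cellSource`.** [folklore] -/
theorem contDiffOn_stabX : ContDiffOn ℝ ∞ (stabX i₀ j₀ θ : E∞ → Mat) (cellSource n R∞) :=
  (contDiffOn_inverse_torusUnip.mul contDiffOn_const).mul contDiff_torusUnip.contDiffOn

/-- **`stabT` is smooth on `cellSource`.** [folklore] -/
theorem contDiffOn_stabT : ContDiffOn ℝ ∞ (stabT v σ i₀ j₀ θ : E∞ → Mat) (cellSource n R∞) :=
  ((contDiff_stabY v σ i₀ j₀ θ).contDiffOn.mul contDiff_cellChart.contDiffOn).neg.add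
    (contDiff_cellChart.contDiffOn.mul (contDiffOn_stabX i₀ j₀ θ))

end Smooth

/-! ### 5. The derivative along bad directions at a point `e₀ = (0, a, 0)` of the cell -/

section BadDeriv

variable (v : PlaceIdx K) (σ : Equiv.Perm (Fin n)) (i₀ j₀ : Fin n) (θ : mixedSpace K)

omit [NumberField K] in
/-- **The commutator `[δ₁, Y₀] w⁰ diag(a)`** — the derivative of `stabT` at `(0, a, 0)` along the bad direction
`(δ₁, 0, 0)`. [folklore] -/
def badDerivMat (i₀ j₀ : Fin n) (θ : R∞) (a : Fin n → R∞) (δ₁ : Mat) : Mat :=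
  (δ₁ * rootLow i₀ j₀ θ - rootLow i₀ j₀ θ * δ₁) * w₀ * Matrix.diagonal a

/-- Along a bad line through `e₀ = (0, a, 0)`, the good unipotent is `1`. [folklore] -/
theorem unipGood_line_bad {e₀ δ : E∞} (h₁ : e₀.1 = 0) (hδ : projB v σ δ = δ) (t : ℝ) : unipGood v σ (e₀ + t • δ) = 1 := by
  obtain ⟨hb, -, -⟩ := (projB_eq_self_iff v σ δ).1 hδ
  rw [unipGood]
  have : ((e₀ + t • δ).1 : Mat) = t • (δ.1 : Mat) := by simp [h₁]
  rw [this, piGood_smul, ← hb, piGood_piBad, smul_zero, add_zero]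

/-- Along a bad line through `e₀ = (0, a, 0)`, the torus–unipotent factor is constant. [folklore] -/
theorem torusUnip_line_bad {e₀ δ : E∞} (h₂ : e₀.2.2 = 0) (hδ : projB v σ δ = δ) (t : ℝ) :
    torusUnip (e₀ + t • δ) = Matrix.diagonal e₀.2.1 := by
  obtain ⟨-, ha, hX₂⟩ := (projB_eq_self_iff v σ δ).1 hδ
  rw [torusUnip]
  have h2' : ((e₀ + t • δ).2.2 : Mat) = 0 := by simp [h₂, hX₂]
  have ha' : (e₀ + t • δ).2.1 = e₀.2.1 := by simp [ha]
  rw [h2', ha', add_zero, Matrix.mul_one]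

/-- Along a bad line through `e₀ = (0, a, 0)`, the chart is `(1 + t δ₁) w⁰ diag(a)`. [folklore] -/
theorem cellChart_line_bad {e₀ δ : E∞} (h₁ : e₀.1 = 0) (h₂ : e₀.2.2 = 0) (hδ : projB v σ δ = δ) (t : ℝ) :
    cellChart (e₀ + t • δ) = (1 + t • (δ.1 : Mat)) * (w₀ * Matrix.diagonal e₀.2.1) := by
  rw [cellChart_eq_mul_torusUnip, torusUnip_line_bad v σ h₂ hδ]
  have : ((e₀ + t • δ).1 : Mat) = t • (δ.1 : Mat) := by simp [h₁]
  rw [this]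

omit [NumberField K] in
/-- The simplification `M (w⁰ D) (D⁻¹ (w⁰ Y₀ w⁰) D) = M Y₀ w⁰ D` for an invertible diagonal `D`. [folklore] -/
theorem mul_weyl_diag_mul_conj {D : Mat} (hD : IsUnit D) (M Y : Mat) :
    M * (w₀ * D) * (Ring.inverse D * (w₀ * Y * w₀) * D) = M * Y * w₀ * D := by
  have h3 : D * Ring.inverse D = 1 := Ring.mul_inverse_cancel _ hD
  have hww : w₀ * w₀ = 1 := weylLong_mul_weylLong
  calc M * (w₀ * D) * (Ring.inverse D * (w₀ * Y * w₀) * D) = M * w₀ * (D * Ring.inverse D) * w₀ * Y * w₀ * D := by noncomm_ring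
    _ = M * (w₀ * w₀) * Y * w₀ * D := by rw [h3]; noncomm_ring
    _ = M * Y * w₀ * D := by rw [hww]; noncomm_ring

/-- **`stabT` along a bad line through `e₀ = (0, a, 0) ∈ cellSource`** (all `s`):
`stabT(e₀ + s δ) = -Y₀ (1 + s δ₁) w⁰ D + (1 + s δ₁) Y₀ w⁰ D`. [cite: Shalika1974, §2] -/
theorem stabT_line_bad_eq {e₀ δ : E∞} (he₀ : e₀ ∈ cellSource n R∞) (h₁ : e₀.1 = 0) (h₂ : e₀.2.2 = 0) (hδ : projB v σ δ = δ) (s : ℝ) :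
    stabT v σ i₀ j₀ θ (e₀ + s • δ) =
      -(rootLow i₀ j₀ θ * ((1 + s • (δ.1 : Mat)) * (w₀ * Matrix.diagonal e₀.2.1))) +
        (1 + s • (δ.1 : Mat)) * rootLow i₀ j₀ θ * w₀ * Matrix.diagonal e₀.2.1 := by
  have hDu : IsUnit (Matrix.diagonal e₀.2.1 : Mat) := ⟨diagUnitsGL e₀.2.1 he₀, rfl⟩
  have hY : stabY v σ i₀ j₀ θ (e₀ + s • δ) = rootLow i₀ j₀ θ := by
    rw [stabY, unipGood_line_bad v σ h₁ hδ, Ring.inverse_one, Matrix.one_mul, Matrix.mul_one]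
  have hX : stabX i₀ j₀ θ (e₀ + s • δ) =
      Ring.inverse (Matrix.diagonal e₀.2.1 : Mat) * (w₀ * rootLow i₀ j₀ θ * w₀) * Matrix.diagonal e₀.2.1 := by
    rw [stabX, torusUnip_line_bad v σ h₂ hδ]
  rw [stabT, hY, hX, cellChart_line_bad v σ h₁ h₂ hδ, mul_weyl_diag_mul_conj hDu]

/-- **`stabT` is affine along a bad line through `e₀ = (0, a, 0) ∈ cellSource`**, with slope
`[δ₁, Y₀] w⁰ diag(a)`. [cite: Shalika1974, §2] -/
theorem stabT_line_bad {e₀ δ : E∞} (he₀ : e₀ ∈ cellSource n R∞) (h₁ : e₀.1 = 0) (h₂ : e₀.2.2 = 0) (hδ : projB v σ δ = δ) (t : ℝ) :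
    stabT v σ i₀ j₀ θ (e₀ + t • δ) = stabT v σ i₀ j₀ θ e₀ + t • badDerivMat i₀ j₀ θ e₀.2.1 (δ.1 : Mat) := by
  have h0 : stabT v σ i₀ j₀ θ e₀ = -(rootLow i₀ j₀ θ * (w₀ * Matrix.diagonal e₀.2.1)) + rootLow i₀ j₀ θ * w₀ * Matrix.diagonal e₀.2.1 := by
    have := stabT_line_bad_eq v σ i₀ j₀ θ he₀ h₁ h₂ hδ 0
    rw [zero_smul, add_zero, zero_smul, add_zero, Matrix.one_mul, Matrix.one_mul] at this
    exact this
  rw [stabT_line_bad_eq v σ i₀ j₀ θ he₀ h₁ h₂ hδ t, h0, badDerivMat]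
  simp only [Matrix.add_mul, Matrix.mul_add, Matrix.smul_mul, Matrix.mul_smul, Matrix.one_mul, Matrix.sub_mul, smul_sub, neg_add,
    Matrix.mul_assoc]
  abel

/-- **The Fréchet derivative of `stabT` at `e₀ = (0, a, 0)` on a bad vector** is `[δ₁, Y₀] w⁰ diag(a)`. [cite: Shalika1974, §2] -/
theorem fderiv_stabT_apply_bad {e₀ δ : E∞} (he₀ : e₀ ∈ cellSource n R∞) (h₁ : e₀.1 = 0) (h₂ : e₀.2.2 = 0) (hδ : projB v σ δ = δ) :
    fderiv ℝ (stabT v σ i₀ j₀ θ) e₀ δ = badDerivMat i₀ j₀ θ e₀.2.1 (δ.1 : Mat) := by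
  have hd : DifferentiableAt ℝ (stabT v σ i₀ j₀ θ) e₀ :=
    ((contDiffOn_stabT v σ i₀ j₀ θ).contDiffAt (isOpen_cellSource.mem_nhds he₀)).differentiableAt (by simp)
  have hγ : HasDerivAt (fun t : ℝ => e₀ + t • δ) δ 0 := by
    simpa using ((hasDerivAt_id (0 : ℝ)).smul_const δ).const_add e₀
  have hcomp : HasDerivAt (fun t : ℝ => stabT v σ i₀ j₀ θ (e₀ + t • δ)) (fderiv ℝ (stabT v σ i₀ j₀ θ) e₀ δ) 0 :=
    hd.hasFDerivAt.comp_hasDerivAt_of_eq (0 : ℝ) hγ (by simp)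
  have hline : (fun t : ℝ => stabT v σ i₀ j₀ θ (e₀ + t • δ)) =
      fun t : ℝ => stabT v σ i₀ j₀ θ e₀ + t • badDerivMat i₀ j₀ θ e₀.2.1 (δ.1 : Mat) :=
    funext fun t => stabT_line_bad v σ i₀ j₀ θ he₀ h₁ h₂ hδ t
  rw [hline] at hcomp
  have haff : HasDerivAt (fun t : ℝ => stabT v σ i₀ j₀ θ e₀ + t • badDerivMat i₀ j₀ θ e₀.2.1 (δ.1 : Mat))
      (badDerivMat i₀ j₀ θ e₀.2.1 (δ.1 : Mat)) 0 := by
    simpa using ((hasDerivAt_id (0 : ℝ)).smul_const (badDerivMat i₀ j₀ θ e₀.2.1 (δ.1 : Mat))).const_add (stabT v σ i₀ j₀ θ e₀)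
  exact hcomp.unique haff

end BadDeriv

/-! ### 6. The field `W = d(Ψ⁻¹)(stabT)` and the nilpotency of its bad linearization -/

section Field

variable (v : PlaceIdx K) (σ : Equiv.Perm (Fin n)) (i₀ j₀ : Fin n) (θ : mixedSpace K)

/-- **The stabilizer field** `W(e) = d(Ψ⁻¹)_{Ψ e} (stabT e)` on the parameter space. [cite: Shalika1974, §2] -/
def fieldW (v : PlaceIdx K) (σ : Equiv.Perm (Fin n)) (i₀ j₀ : Fin n) (θ : R∞) (e : E∞) : E∞ :=
  fderiv ℝ (cellChartHomeo n R∞).symm (cellChart e) (stabT v σ i₀ j₀ θ e)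

/-- `W` vanishes on the cell. [folklore] -/
theorem fieldW_eq_zero_of_piBad_eq_zero {e : E∞} (he : e ∈ cellSource n R∞) (hb : piBad v σ (e.1 : Mat) = 0) :
    fieldW v σ i₀ j₀ θ e = 0 := by
  rw [fieldW, stabT_eq_zero_of_piBad_eq_zero v σ i₀ j₀ θ he hb, map_zero]

/-- `W` is smooth on `cellSource`. [folklore] -/
theorem contDiffOn_fieldW : ContDiffOn ℝ ∞ (fieldW v σ i₀ j₀ θ : E∞ → E∞) (cellSource n R∞) :=
  contDiffOn_fderiv_symm_cellChart.clm_apply (contDiffOn_stabT v σ i₀ j₀ θ)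

/-- **The derivative of `W` at a point of the cell**: `DW(e₀) = dΨ_{e₀}⁻¹ ∘ D(stabT)(e₀)` (the term
`D(dΨ⁻¹)·stabT(e₀)` vanishes with `stabT(e₀)`). [folklore] -/
theorem hasFDerivAt_fieldW {e₀ : E∞} (he₀ : e₀ ∈ cellSource n R∞) (hb : piBad v σ (e₀.1 : Mat) = 0) :
    HasFDerivAt (fieldW v σ i₀ j₀ θ)
      ((fderiv ℝ (cellChartHomeo n R∞).symm (cellChart e₀)).comp (fderiv ℝ (stabT v σ i₀ j₀ θ) e₀)) e₀ := by
  have hΦ := ((contDiffOn_fderiv_symm_cellChart (n := n) (K := K)).contDiffAt (isOpen_cellSource.mem_nhds he₀)).differentiableAt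
    (by simp)
  have hT : DifferentiableAt ℝ (stabT v σ i₀ j₀ θ) e₀ :=
    ((contDiffOn_stabT v σ i₀ j₀ θ).contDiffAt (isOpen_cellSource.mem_nhds he₀)).differentiableAt (by simp)
  have h := hΦ.hasFDerivAt.clm_apply hT.hasFDerivAt
  have hz : (fderiv ℝ (fun e : E∞ => fderiv ℝ (cellChartHomeo n R∞).symm (cellChart e)) e₀).flip (stabT v σ i₀ j₀ θ e₀) = 0 := by
    rw [stabT_eq_zero_of_piBad_eq_zero v σ i₀ j₀ θ he₀ hb]
    exact ContinuousLinearMap.map_zero _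
  rw [hz, add_zero] at h
  exact h

/-- **`DW(e₀)` on a bad vector**, at `e₀ = (0, a, 0)`: `DW(e₀) δ = dΨ_{e₀}⁻¹ ([δ₁, Y₀] w⁰ diag(a))`. [cite: Shalika1974, §2] -/
theorem fderiv_fieldW_apply_bad {e₀ δ : E∞} (he₀ : e₀ ∈ cellSource n R∞) (h₁ : e₀.1 = 0) (h₂ : e₀.2.2 = 0)
    (hδ : projB v σ δ = δ) :
    fderiv ℝ (fieldW v σ i₀ j₀ θ) e₀ δ = cellTangentInv e₀ he₀ (badDerivMat i₀ j₀ θ e₀.2.1 (δ.1 : Mat)) := by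
  have hb : piBad v σ (e₀.1 : Mat) = 0 := by
    have h0 : ((e₀.1 : ↥(strictUpperReal n R∞)) : Mat) = 0 := by rw [h₁]; rfl
    rw [h0, piBad_zero]
  have h := congrArg (fun L : E∞ →L[ℝ] E∞ => L δ) (hasFDerivAt_fieldW v σ i₀ j₀ θ he₀ hb).fderiv
  simp only [ContinuousLinearMap.coe_comp, Function.comp_apply] at h
  rw [h, fderiv_stabT_apply_bad v σ i₀ j₀ θ he₀ h₁ h₂ hδ]
  exact fderiv_cellChartHomeo_symm_apply he₀ _

/-- **The bad part of the `X₁`-component of `DW(e₀) δ` is `π''([δ₁, Y₀])`** for a bad vector `δ`. [cite: Shalika1974, §2] -/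
theorem projB_fderiv_fieldW_apply_bad {e₀ δ : E∞} (he₀ : e₀ ∈ cellSource n R∞) (h₁ : e₀.1 = 0) (h₂ : e₀.2.2 = 0)
    (hδ : projB v σ δ = δ) :
    ((projB v σ (fderiv ℝ (fieldW v σ i₀ j₀ θ) e₀ δ)).1 : Mat) =
      piBad v σ ((δ.1 : Mat) * rootLow i₀ j₀ θ - rootLow i₀ j₀ θ * (δ.1 : Mat)) := by
  rw [projB_fst, fderiv_fieldW_apply_bad v σ i₀ j₀ θ he₀ h₁ h₂ hδ]
  funext p q
  rw [piBad_apply, piBad_apply]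
  split_ifs with hpq
  · rw [cellTangentInv_fst_apply_of_zero he₀ h₁ h₂, if_pos hpq.1, badDerivMat, Matrix.mul_diagonal, mul_weylLong_apply, Fin.rev_rev,
      mul_assoc, IsUnit.mul_val_inv, mul_one]
  · rfl

/-- Vectors in the image of `projB` whose bad entries of height `> k` vanish. [folklore] -/
def BadHeightLE (v : PlaceIdx K) (σ : Equiv.Perm (Fin n)) (k : ℤ) (δ : E∞) : Prop :=
  projB v σ δ = δ ∧ ∀ p q : Fin n, k < (q : ℤ) - (p : ℤ) → ((δ.1 : Mat)) p q = 0

omit [NumberField K] in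
/-- The commutator with `Y₀ = θ E_{j₀ i₀}` lowers heights by `j₀ - i₀ ≥ 1`: if the entries of `X` of height
`> k` vanish then those of `[X, Y₀]` of height `> k - 1` vanish (for `i₀ < j₀`). [folklore] -/
theorem comm_rootLow_apply_eq_zero {X : Mat} {k : ℤ} (hX : ∀ p q : Fin n, k < (q : ℤ) - (p : ℤ) → X p q = 0)
    (hij : i₀ < j₀) {p q : Fin n} (hpq : k - 1 < (q : ℤ) - (p : ℤ)) :
    (X * rootLow i₀ j₀ θ - rootLow i₀ j₀ θ * X) p q = 0 := by
  have hij' : (i₀ : ℤ) + 1 ≤ (j₀ : ℤ) := by have := Fin.lt_def.1 hij; omega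
  have e1 : (X * Matrix.single j₀ i₀ θ) p q = if q = i₀ then X p j₀ * θ else 0 := by
    split_ifs with h
    · rw [h]; exact Matrix.mul_single_apply_same θ j₀ i₀ p X
    · exact Matrix.mul_single_apply_of_ne θ j₀ i₀ p q h X
  have e2 : (Matrix.single j₀ i₀ θ * X) p q = if p = j₀ then θ * X i₀ q else 0 := by
    split_ifs with h
    · rw [h]; exact Matrix.single_mul_apply_same θ j₀ i₀ q X
    · exact Matrix.single_mul_apply_of_ne θ j₀ i₀ p q h X
  rw [Matrix.sub_apply, rootLow, e1, e2]
  by_cases hq : q = i₀ <;> by_cases hp : p = j₀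
  · have hq' : (q : ℤ) = i₀ := by rw [hq]
    have hp' : (p : ℤ) = j₀ := by rw [hp]
    rw [if_pos hq, if_pos hp, hX p j₀ (by omega), hX i₀ q (by omega)]; ring
  · have hq' : (q : ℤ) = i₀ := by rw [hq]
    rw [if_pos hq, if_neg hp, hX p j₀ (by omega)]; ring
  · have hp' : (p : ℤ) = j₀ := by rw [hp]
    rw [if_neg hq, if_pos hp, hX i₀ q (by omega)]; ring
  · rw [if_neg hq, if_neg hp]; ring

/-- **The bad linearization lowers heights**: `δ ↦ P (DW(e₀) (P δ))` maps `BadHeightLE k` into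
`BadHeightLE (k - 1)` (for a bad pair `i₀ < j₀`). [folklore] -/
theorem badHeightLE_step {e₀ : E∞} (he₀ : e₀ ∈ cellSource n R∞) (h₁ : e₀.1 = 0) (h₂ : e₀.2.2 = 0) (hij : i₀ < j₀)
    {k : ℤ} {δ : E∞} (hδ : BadHeightLE v σ k δ) :
    BadHeightLE v σ (k - 1) (projB v σ (fderiv ℝ (fieldW v σ i₀ j₀ θ) e₀ (projB v σ δ))) := by
  refine ⟨projB_projB v σ _, fun p q hpq => ?_⟩
  rw [projB_fderiv_fieldW_apply_bad v σ i₀ j₀ θ he₀ h₁ h₂ (projB_projB v σ δ), hδ.1, piBad_apply]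
  split_ifs with hbad
  · rw [comm_rootLow_apply_eq_zero i₀ j₀ θ hδ.2 hij hpq, mul_zero]
  · rfl

/-- Every vector is sent into `BadHeightLE (n - 1)` by `δ ↦ P (DW(e₀) (P δ))`. [folklore] -/
theorem badHeightLE_top {e₀ : E∞} (δ : E∞) :
    BadHeightLE v σ ((n : ℤ) - 1) (projB v σ (fderiv ℝ (fieldW v σ i₀ j₀ θ) e₀ (projB v σ δ))) := by
  refine ⟨projB_projB v σ _, fun p q hpq => ?_⟩
  exfalso
  have hq := q.2; have := p.2
  omega

/-- A vector of `BadHeightLE (-1)` vanishes. [folklore] -/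
theorem eq_zero_of_badHeightLE_neg {δ : E∞} (hδ : BadHeightLE v σ (-1) δ) : δ = 0 := by
  obtain ⟨hP, hz⟩ := hδ
  obtain ⟨hb, ha, hX₂⟩ := (projB_eq_self_iff v σ δ).1 hP
  have h1 : (δ.1 : Mat) = 0 := by
    funext p q
    by_cases hpq : p < q
    · exact hz p q (by have := Fin.lt_def.1 hpq; omega)
    · rw [← hb, piBad_apply, if_neg (fun h => hpq h.1)]; rfl
  obtain ⟨X₁, a, X₂⟩ := δ
  simp only at h1 ha hX₂
  rw [Prod.mk_eq_zero, Prod.mk_eq_zero]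
  exact ⟨Subtype.ext h1, ha, hX₂⟩

set_option synthInstance.maxHeartbeats 200000 in
/-- **The bad linearization `P ∘ DW(e₀) ∘ P` is nilpotent** (`P = projB`, `e₀ = (0, a, 0) ∈ cellSource`, bad pair
`i₀ < j₀`): it strictly lowers the height of bad matrix units. [cite: Shalika1974, §2] -/
theorem isNilpotent_projB_fderiv_fieldW_projB {e₀ : E∞} (he₀ : e₀ ∈ cellSource n R∞) (h₁ : e₀.1 = 0) (h₂ : e₀.2.2 = 0)
    (hij : i₀ < j₀) :
    IsNilpotent ((projB v σ).comp ((fderiv ℝ (fieldW v σ i₀ j₀ θ) e₀).comp (projB v σ))) := by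
  set Q : E∞ →L[ℝ] E∞ := (projB v σ).comp ((fderiv ℝ (fieldW v σ i₀ j₀ θ) e₀).comp (projB v σ)) with hQ
  have hQapply : ∀ δ, Q δ = projB v σ (fderiv ℝ (fieldW v σ i₀ j₀ θ) e₀ (projB v σ δ)) := fun δ => rfl
  -- `Q^{m+1} δ ∈ BadHeightLE (n - 1 - m)`
  have key : ∀ (m : ℕ) (δ : E∞), BadHeightLE v σ ((n : ℤ) - 1 - m) ((Q ^ (m + 1)) δ) := by
    intro m
    induction m with
    | zero =>
      intro δ
      rw [zero_add, pow_one, hQapply]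
      simpa using badHeightLE_top v σ i₀ j₀ θ (e₀ := e₀) δ
    | succ m ih =>
      intro δ
      rw [pow_succ', mul_apply_eq_comp, hQapply]
      have h := badHeightLE_step v σ i₀ j₀ θ he₀ h₁ h₂ hij (ih δ)
      have hk : (n : ℤ) - 1 - m - 1 = (n : ℤ) - 1 - (m + 1 : ℕ) := by push_cast; ring
      rw [hk] at h
      exact h
  refine ⟨n + 1, ContinuousLinearMap.ext fun δ => ?_⟩
  have h := key n δ
  have hk : (n : ℤ) - 1 - n = -1 := by ring
  rw [hk] at h
  rw [eq_zero_of_badHeightLE_neg v σ h]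
  rfl

end Field

end Literature.NumberTheory.Automorphic
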